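import Summits.ValiantsHypothesis.ValiantsHypothesis.Theses.UlrichPadded
import Literature.Computability.AlgebraicComplexity.PermanentIrreducible
import Literature.LinearAlgebra.Matrix.PermanentSubperm

/-!
# `PermHypersurfaceFactorial` (stmt-ValiantsHypothesis-5666) — negative lemma, part 1/3:
# the determinantal prime of `S_3` in characteristic two, and `ht P ≤ 1`

Three files (`CharTwoKernelPrime`, `CharTwoTwoJets`, `CharTwoNotFactorial`) prove that over a field
`K` of characteristic TWO the crux's statement ("`K[x_{n×n}]/(per_n)` is factorial, `n ≥ 3`") is
FALSE at `n = 3`: `¬ UniqueFactorizationMonoid (K[x_{3×3}]/(per₃))` (`per₃ = det₃`,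
`Cl(K[x]/(det₃)) ≠ 0`, Bruns–Vetter) — the crux's field `ℂ` (precisely `2 ≠ 0`) is load-bearing,
consistent with the barrier `Literature.Barriers.ValiantsHypothesis.PermanentCharTwo`.
Extracted from the standing disprover's workfile `Cruxes/PermHypersurfaceFactorial/Disproof.lean` §14
(refuter-cdisprove gen-3, 2026-08-16); self-contained, standard axioms.

THIS FILE: notation `R K n = K[x]`, `S K n = K[x]/(per_n)`; the prime
`P := ker Φ`, `Φ : S_3 → K[x]` the descent of `x_{0j} ↦ x_{0j}`, `x_{1j} ↦ s v_j`, `x_{2j} ↦ t v_j`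
(rows `1,2` proportional — kills `per₃` exactly in characteristic two; `P = I₂(rows 1,2)/(per₃)`
set-theoretically), the chain of seven kernels `P_T` strictly above it (`PD_strict`) and
`dim S_3 ≤ 8` (`height_succ_le_nine`), whence `height_PD_zero_le_one : ht P ≤ 1` — no primality of a
determinantal ideal is ever needed (every `P_T` is a kernel into a domain).
-/

noncomputable section

namespace Summit.ValiantsHypothesis.Theorems.PermHypersurfaceFactorial.Negative.CharTwo

open MvPolynomial Literature.Computability.AlgebraicComplexity
open scoped DualNumber

/-! ## Notation and elementary tools (from the disprover's workfile §§0–4) -/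

/-- The polynomial ring `K[x_ij]`, `i, j < n`. [folklore] -/
abbrev R (K : Type*) [CommRing K] (n : ℕ) : Type _ := MvPolynomial (Fin n × Fin n) K

/-- The principal ideal `(per_n)`. [folklore] -/
abbrev perIdeal (K : Type*) [CommRing K] (n : ℕ) : Ideal (R K n) := Ideal.span {perPoly (Fin n) K}

/-- The permanental hypersurface ring `S_n = K[x_ij]/(per_n)`. [folklore] -/
abbrev S (K : Type*) [CommRing K] (n : ℕ) : Type _ := R K n ⧸ perIdeal K n

/-- The image `x̄_p` of a variable in `S_n`. [folklore] -/
abbrev xbar (K : Type*) [CommRing K] {n : ℕ} (p : Fin n × Fin n) : S K n :=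
  Ideal.Quotient.mk (perIdeal K n) (X p)

/-- `per_n` is a prime polynomial for `n ≥ 1` (vzG Thm 3.4, tree `perPoly_irreducible`, + Gauss).
[folklore] -/
theorem perPoly_prime (K : Type*) [Field K] {n : ℕ} (hn : 1 ≤ n) : Prime (perPoly (Fin n) K) := by
  haveI : Nonempty (Fin n) := ⟨⟨0, hn⟩⟩
  exact UniqueFactorizationMonoid.irreducible_iff_prime.mp perPoly_irreducible

/-- `S_n` is an integral domain for `n ≥ 1`. [folklore] -/
theorem isDomain_S (K : Type*) [Field K] {n : ℕ} (hn : 1 ≤ n) : IsDomain (S K n) := by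
  haveI : (perIdeal K n).IsPrime :=
    (Ideal.span_singleton_prime (perPoly_prime K hn).ne_zero).mpr (perPoly_prime K hn)
  exact Ideal.Quotient.isDomain _

section Explicit

variable (K : Type*) [CommRing K]

/-- `per_3`, expanded along row `0`. [folklore] -/
theorem perPoly_three : perPoly (Fin 3) K =
    X (0, 0) * (X (1, 1) * X (2, 2) + X (1, 2) * X (2, 1)) +
      X (0, 1) * (X (1, 0) * X (2, 2) + X (1, 2) * X (2, 0)) +
        X (0, 2) * (X (1, 0) * X (2, 1) + X (1, 1) * X (2, 0)) := by
  simp [perPoly, Matrix.permanent_fin_three_row, Matrix.mvPolynomialX]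

end Explicit

section Tools

variable {K : Type*} [CommRing K] {σ : Type*}

/-- A polynomial is outside `span s` as soon as some evaluation kills `s` but not it. [folklore] -/
theorem not_mem_span_of_eval (v : σ → K) {s : Set (MvPolynomial σ K)} {f : MvPolynomial σ K}
    (hs : ∀ g ∈ s, eval v g = 0) (hf : eval v f ≠ 0) : f ∉ Ideal.span s := by
  intro h
  have hle : Ideal.span s ≤ RingHom.ker (eval v) :=
    Ideal.span_le.mpr fun g hg => (RingHom.mem_ker).mpr (hs g hg)
  exact hf ((RingHom.mem_ker).mp (hle h))

end Tools



section KillVars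

variable {K : Type*} [CommRing K] {σ : Type*} (T : Set σ) [DecidablePred (· ∈ T)]

/-- Substitute `0` for the variables in `T`. [folklore] -/
def killVars : MvPolynomial σ K →ₐ[K] MvPolynomial σ K :=
  aeval fun p => if p ∈ T then 0 else X p

/-- `killVars_X`: auxiliary (see the module docstring). [folklore] -/
@[simp] theorem killVars_X (p : σ) :
    killVars (K := K) T (X p) = if p ∈ T then 0 else X p :=
  aeval_X _ _

end KillVars

/-! ## The field is load-bearing: in characteristic two `S_3` is not factorial -/

section CharTwoNotUFD

open scoped Classical

variable (K : Type*) [Field K]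

/-! ### Stage 1: the determinantal prime `P = I₂(rows 1,2)/(per₃)` as a kernel, and `ht P ≤ 1` -/

/-- Images of the variables under `φ`: row `0` kept, rows `1, 2` made proportional
(`x_{1j} ↦ s v_j`, `x_{2j} ↦ t v_j` with `s = x₁₀`, `t = x₁₁`, `v_j = x_{2j}`). [folklore] -/
def phiFun (p : Fin 3 × Fin 3) : R K 3 :=
  if (p.1 : ℕ) = 0 then X p else if (p.1 : ℕ) = 1 then X (1, 0) * X (2, p.2) else X (1, 1) * X (2, p.2)

/-- `φ : K[x] → K[x]`. [folklore] -/
def phi : R K 3 →ₐ[K] R K 3 := aeval (phiFun K)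

/-- `phi_X`: auxiliary (see the module docstring). [folklore] -/
@[simp] theorem phi_X (p : Fin 3 × Fin 3) : phi K (X p) = phiFun K p := aeval_X _ _

/-- In characteristic two a matrix with two proportional rows has permanent `0`: `φ(per₃) = 0`. [folklore] -/
theorem phi_perPoly [CharP K 2] : phi K (perPoly (Fin 3) K) = 0 := by
  have h2 : (2 : R K 3) = 0 := by
    have := CharP.cast_eq_zero (R K 3) 2
    simpa using this
  rw [perPoly_three]
  simp [phiFun]
  linear_combination (X (1, 0) * X (1, 1) * (X (0, 0) * X (2, 1) * X (2, 2) +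
    X (0, 1) * X (2, 0) * X (2, 2) + X (0, 2) * X (2, 0) * X (2, 1))) * h2

/-- Killing more variables factors through killing fewer. [folklore] -/
theorem killVars_comp_killVars {σ : Type*} {T T' : Set σ} (h : T ⊆ T') :
    (killVars (K := K) T').comp (killVars (K := K) T) = killVars (K := K) T' := by
  apply MvPolynomial.algHom_ext
  intro p
  simp only [AlgHom.comp_apply, killVars_X]
  by_cases hp : p ∈ T
  · rw [if_pos hp, map_zero, if_pos (h hp)]
  · rw [if_neg hp, killVars_X]

/-- Every prime of `S_3` has height `≤ 8` (`dim S_3 + 1 ≤ dim K[x_{3×3}] = 9`). [folklore] -/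
theorem height_succ_le_nine (P : Ideal (S K 3)) [P.IsPrime] : P.height + 1 ≤ 9 := by
  haveI : IsDomain (S K 3) := isDomain_S K (by norm_num)
  have h0 : (0 : WithBot ℕ∞) ≤ ringKrullDim (S K 3) := ringKrullDim_nonneg_of_nontrivial
  have hne : ringKrullDim (S K 3) ≠ ⊥ := by
    intro h
    rw [h] at h0
    exact WithBot.not_coe_le_bot 0 h0
  obtain ⟨d, hd⟩ := WithBot.ne_bot_iff_exists.mp hne
  have h1 : (P.height : WithBot ℕ∞) ≤ ringKrullDim (S K 3) := Ideal.height_le_ringKrullDim_of_isPrime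
  have h2 : ringKrullDim (S K 3) + 1 ≤ ringKrullDim (R K 3) :=
    ringKrullDim_quotient_succ_le_of_nonZeroDivisor
      (mem_nonZeroDivisors_of_ne_zero (perPoly_prime K (n := 3) (by norm_num)).ne_zero)
  have h3 : ringKrullDim (R K 3) = ((9 : ℕ∞) : WithBot ℕ∞) := by
    rw [MvPolynomial.ringKrullDim_of_isNoetherianRing, ringKrullDim_eq_zero_of_field]
    simp
  rw [← hd] at h1 h2
  rw [h3] at h2
  have h1' : P.height ≤ d := WithBot.coe_le_coe.mp h1
  have h2' : d + 1 ≤ 9 := by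
    rw [← WithBot.coe_one, ← WithBot.coe_add] at h2
    exact WithBot.coe_le_coe.mp h2
  exact (add_le_add h1' le_rfl).trans h2'

variable [CharP K 2]

/-- `Φ : S_3 → K[x]`, the descent of `φ`. [folklore] -/
def Phi : S K 3 →ₐ[K] R K 3 :=
  Ideal.Quotient.liftₐ (perIdeal K 3) (phi K) fun a ha => by
    obtain ⟨r, rfl⟩ := Ideal.mem_span_singleton'.mp ha
    rw [map_mul, phi_perPoly, mul_zero]

/-- `Phi_mk`: auxiliary (see the module docstring). [folklore] -/
@[simp] theorem Phi_mk (f : R K 3) : Phi K (Ideal.Quotient.mk (perIdeal K 3) f) = phi K f := rfl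

/-- `P_T = ker (kill T ∘ Φ) ⊂ S_3`, prime. [folklore] -/
def PD (T : Set (Fin 3 × Fin 3)) : Ideal (S K 3) :=
  RingHom.ker ((killVars (K := K) T).comp (Phi K))

/-- `PD_isPrime`: auxiliary (see the module docstring). [folklore] -/
instance PD_isPrime (T : Set (Fin 3 × Fin 3)) : (PD K T).IsPrime := RingHom.ker_isPrime _

/-- `mem_PD_mk`: auxiliary (see the module docstring). [folklore] -/
theorem mem_PD_mk (T : Set (Fin 3 × Fin 3)) (f : R K 3) :
    Ideal.Quotient.mk (perIdeal K 3) f ∈ PD K T ↔ killVars (K := K) T (phi K f) = 0 := by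
  rw [PD, RingHom.mem_ker]
  rfl

/-- `PD_mono`: auxiliary (see the module docstring). [folklore] -/
theorem PD_mono {T T' : Set (Fin 3 × Fin 3)} (h : T ⊆ T') : PD K T ≤ PD K T' := by
  intro z hz
  obtain ⟨f, rfl⟩ := Ideal.Quotient.mk_surjective z
  rw [mem_PD_mk] at hz ⊢
  rw [← killVars_comp_killVars K h, AlgHom.comp_apply, hz, map_zero]

/-- The chain of variables killed above `P`: `v₂, v₁, t, s, y₀, y₁, y₂`. [folklore] -/
def chainList : List (Fin 3 × Fin 3) := [(2, 2), (2, 1), (1, 1), (1, 0), (0, 0), (0, 1), (0, 2)]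

/-- `T_k` = the first `k` killed variables. [folklore] -/
def Tk (k : ℕ) : Set (Fin 3 × Fin 3) := {p | p ∈ chainList.take k}

/-- `Tk_mono`: auxiliary (see the module docstring). [folklore] -/
theorem Tk_mono {k l : ℕ} (h : k ≤ l) : Tk k ⊆ Tk l := fun _ hp =>
  (List.take_prefix_take_left h).subset hp

/-- The witness of strictness at step `k`: `x̄_{w_k} ∈ P_{k+1} ∖ P_k`. [folklore] -/
theorem PD_strict (k : Fin 7) : PD K (Tk k) < PD K (Tk (k + 1)) := by
  refine lt_of_le_of_ne (PD_mono K (Tk_mono (Nat.le_succ _))) ?_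
  intro heq
  have key : ∀ p : Fin 3 × Fin 3, xbar K p ∈ PD K (Tk (k + 1)) → xbar K p ∈ PD K (Tk k) := by
    intro p hp; rwa [heq]
  fin_cases k
  · have h := key (1, 2) (by rw [xbar, mem_PD_mk]; simp [phiFun, Tk, chainList])
    rw [xbar, mem_PD_mk] at h
    simp [phiFun, Tk, chainList] at h
  · have h := key (1, 1) (by rw [xbar, mem_PD_mk]; simp [phiFun, Tk, chainList])
    rw [xbar, mem_PD_mk] at h
    simp [phiFun, Tk, chainList] at h
  · have h := key (2, 0) (by rw [xbar, mem_PD_mk]; simp [phiFun, Tk, chainList])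
    rw [xbar, mem_PD_mk] at h
    simp [phiFun, Tk, chainList] at h
  · have h := key (1, 0) (by rw [xbar, mem_PD_mk]; simp [phiFun, Tk, chainList])
    rw [xbar, mem_PD_mk] at h
    simp [phiFun, Tk, chainList] at h
  · have h := key (0, 0) (by rw [xbar, mem_PD_mk]; simp [phiFun, Tk, chainList])
    rw [xbar, mem_PD_mk] at h
    simp [phiFun, Tk, chainList] at h
  · have h := key (0, 1) (by rw [xbar, mem_PD_mk]; simp [phiFun, Tk, chainList])
    rw [xbar, mem_PD_mk] at h
    simp [phiFun, Tk, chainList] at h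
  · have h := key (0, 2) (by rw [xbar, mem_PD_mk]; simp [phiFun, Tk, chainList])
    rw [xbar, mem_PD_mk] at h
    simp [phiFun, Tk, chainList] at h

/-- **`ht P ≤ 1`** for `P = P_∅ = ker Φ` (seven primes sit strictly above it). [folklore] -/
theorem height_PD_zero_le_one : (PD K (Tk 0)).height ≤ 1 := by
  have hchain : ∀ k : ℕ, k ≤ 7 → (PD K (Tk 0)).height + k ≤ (PD K (Tk k)).height := by
    intro k hk
    induction k with
    | zero => simp
    | succ k ih =>
      have ih' := ih (by omega)
      have hlt := PD_strict K ⟨k, by omega⟩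
      have hstep := Ideal.height_add_one_le_of_lt_of_isPrime hlt
      push_cast
      rw [← add_assoc]
      exact (add_le_add ih' le_rfl).trans hstep
  have h7 := hchain 7 le_rfl
  have htop := height_succ_le_nine K (PD K (Tk 7))
  set h := (PD K (Tk 0)).height with hh
  have hfin : h ≠ ⊤ := by
    intro ht
    rw [ht, top_add] at h7
    have h1 := top_le_iff.mp h7
    rw [h1, top_add] at htop
    exact absurd htop (by decide)
  obtain ⟨k, hk⟩ := ENat.ne_top_iff_exists.mp hfin
  rw [← hk] at h7 ⊢
  have hfin' : (PD K (Tk 7)).height ≠ ⊤ := by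
    intro ht
    rw [ht, top_add] at htop
    exact absurd htop (by decide)
  obtain ⟨k', hk'⟩ := ENat.ne_top_iff_exists.mp hfin'
  rw [← hk'] at h7 htop
  have e1 : k + 7 ≤ k' := by exact_mod_cast h7
  have e2 : k' + 1 ≤ 9 := by exact_mod_cast htop
  have e3 : k ≤ 1 := by omega
  exact_mod_cast e3

end CharTwoNotUFD


end Summit.ValiantsHypothesis.Theorems.PermHypersurfaceFactorial.Negative.CharTwo

end
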